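import Mathlib.AlgebraicGeometry.Morphisms.Proper
import Mathlib.AlgebraicGeometry.RelativeGluing
import HarnessLib

/-!
# Gluing a scheme over one open to the base along an open where it is an isomorphism (named fact)

Topic: `Literature/AlgebraicGeometry/Morphisms`. The two-piece case of RELATIVE GLUING (The Stacks
Project, Tag 01LH: "Let `S` be a scheme, `S = ⋃ Uᵢ` an open covering, `fᵢ : Xᵢ → Uᵢ` schemes over
the members with isomorphisms of the restrictions over `Uᵢ ∩ Uⱼ` satisfying the cocycle
condition; then there is `f : X → S` with `f⁻¹(Uᵢ) ≅ Xᵢ` over `Uᵢ`"), in the only form Zariski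
patching needs: `S = V ∪ W`, `X_V = Y → V` arbitrary, `X_W = W`, glued along `π⁻¹(V ∩ W) ≅ V ∩ W`
(so the cocycle condition is empty). Recorded as a NAMED FACT `OpenGluing` (`def … : Prop`);
Mathlib has the general engine (`AlgebraicGeometry.Scheme.Cover.RelativeGluingData.glued`,
`isPullback_natTrans_ι_toBase`, file `Mathlib/AlgebraicGeometry/RelativeGluing.lean`), from which
the discharge `OpenGluing_holds` is expected to be a bookkeeping exercise (locally directed
two-piece cover `{V, W, V ⊓ W}`; properness of the glued map is Zariski-local on the target).

## References

* The Stacks Project, Tag 01LH (relative glueing of schemes). [StacksProject]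
-/

noncomputable section

open CategoryTheory AlgebraicGeometry

namespace Literature.AlgebraicGeometry.Morphisms

universe u

/-- NAMED FACT — **relative gluing, two pieces** (The Stacks Project, Tag 01LH, with cover
`{V, W}`, `X_V = Y`, `X_W = W`): for opens `V, W` covering a scheme `S` and a morphism
`π : Y → V` which is an isomorphism over `V ∩ W`, there are a scheme `N`, a morphism `ρ : N → S`
and an open immersion `i : Y → N` forming a cartesian square with `π` and `V ↪ S` (so
`ρ⁻¹(V) = Y` over `V`), such that `ρ` is an isomorphism over `W`; moreover `ρ` is proper when
`π` is (properness is local on the target). Users take `(h : OpenGluing)`.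
[cite: StacksProject, Tag 01LH] -/
def OpenGluing : Prop :=
  ∀ (S : Scheme.{u}) (V W : S.Opens), V ⊔ W = ⊤ → ∀ (Y : Scheme.{u}) (π : Y ⟶ (V : Scheme.{u})),
    IsIso (π ∣_ (V.ι ⁻¹ᵁ W)) →
      ∃ (N : Scheme.{u}) (ρ : N ⟶ S) (i : Y ⟶ N), IsOpenImmersion i ∧
        IsPullback i π ρ V.ι ∧ IsIso (ρ ∣_ W) ∧ (IsProper π → IsProper ρ)

end Literature.AlgebraicGeometry.Morphisms

end
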